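import Summits.BirchSwinnertonDyer.BirchSwinnertonDyer.Theorems.AlignedTransportAtTwoMainConjectureOfRankZeroBSDAtTwoLayerValueDoublyDark
import Summits.BirchSwinnertonDyer.BirchSwinnertonDyer.Theorems.AlignedTransportAtTwoMainConjectureOfRankZeroBSDAtTwoLambdaSeed
import HarnessLib

/-!
# Route `AlignedTransportAtTwo`, crux C2 `MainConjectureOfRankZeroBSDAtTwo` (stmt-BirchSwinnertonDyer-22298):
# THE KATO-CONSISTENCY LAW ON THE DOUBLY-DARK CELL — `λ_an ≥ 4` on every doubly-dark seed with `μ_alg = 0`; equivalently a doubly-dark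
# seed whose `2`-adic `L`-function has `λ ≤ 3` (e.g. `λ_an = 2`) would be a counterexample to Greenberg's `μ`-conjecture at `2`

HONEST FRAMING (cell `bsd-f1-sign2`, WIDTH-5 attached prover seat `bsd-line-att-p5` gen 50 on line `birth` of the lead
`bsd-line-att-p2`; `--supports` stmt-BirchSwinnertonDyer-22298, closes nothing; BSD is NOT proved by any of this; the crux C2, its
verdict «blocked-on `Rank1Residual.GreenbergMuConjectureIrreducible`» and every registered stub are untouched). THEOREMS ONLY — no `def`,
no instance, no named fact, no `sorry`. PRINT binders: `h17` (Kato 17.4 (1)(2) at `2` for the newform `f`), `hper` (period unit), `hGZK`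
(Gross–Zagier–Kolyvagin), `h114` (Greenberg Thm. 1.14); Greenberg's Thm. 4.1 is the KERNEL theorem `thm41_charValue_rankZero_anyPrime_holds`.

THE POINT. Sibling `…LayerValueDoublyDark`: on the clean doubly-dark cell (`e(W) = 2`, displayed twin value `ord₂ f_X(−2) = 2`, `ι`-stable
`char X` by Thm. 1.14) `μ(X) = 0 ⟹ λ(X) ≥ 4`. Kato's divisibility at `2` in invariants (tree `lambda_le_lam_of_kato`: `λ(X) ≤ λ(G)` for any
integral lift `G` of `L₂(f, α)`) turns this into a statement about the ANALYTIC `λ`: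
* ★★★ `four_le_lam_lift_of_doublyDark_of_mu_eq_zero`: doubly dark ∧ `μ(X) = 0` at a normalised datum ⟹ **`λ(G) ≥ 4`** for every integral lift `G`
  of `L₂(f, α)` — the census law «`λ_an ≥ 4` on doubly-dark seeds» (bsd-2adic S2TOWER: 14/14, `λ_an ∈ {4, 6, 8, 10}`), now a CONSEQUENCE of
  Greenberg's conjecture + print;
* ★★★ `one_le_mu_of_doublyDark_of_lam_lift_le_three`: conversely a doubly-dark seed with an integral lift of `λ(G) ≤ 3` (e.g. `λ_an = 2`) has
  **`μ(X(W/ℚ_∞)) ≥ 1`** at that datum — a CHEAP FALSIFIER of Greenberg's `μ`-conjecture on the cell: compute `λ_an` (modular symbols) on the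
  113 doubly-dark seeds; any `λ_an ≤ 3` refutes `μ = 0` (given the displayed twin value and print). 0 of 14 so far.
Memo `Cruxes/MainConjectureOfRankZeroBSDAtTwo/LAYER-VALUE-att-p5-g50.md`. BSD is not proved by any of this; no particular curve is certified here.

References: K. Kato, Astérisque 295 (2004), Thm. 17.4 [Kato2004Asterisque]; R. Greenberg, LNM 1716 (1999), Thm. 1.14, Thm. 4.1, Conj. 1.11
[GreenbergLNM1716]; L. Washington, GTM 83, §7.1 [Washington1997].
-/

set_option linter.dupNamespace false
set_option autoImplicit false

noncomputable section

open scoped Classical MatrixGroups ModularForm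

namespace Summit.BirchSwinnertonDyer.BirchSwinnertonDyer.Theorems.AlignedTransportAtTwoLayerValueDoublyDarkKato

open PowerSeries CongruenceSubgroup WeierstrassCurve Literature.NumberTheory.EllipticCurves
  Literature.NumberTheory.EllipticCurves.IwasawaAlgebra
  Literature.NumberTheory.EllipticCurves.ModularForms
  Literature.NumberTheory.EllipticCurves.Rank1Residual
  Literature.NumberTheory.EllipticCurves.Rank1Residual.Typed
  Literature.NumberTheory.EllipticCurves.Greenberg1999
  Summit.BirchSwinnertonDyer.Rank1Residual
  Summit.BirchSwinnertonDyer.Rank1Residual.X1.MuLambda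
  Summit.BirchSwinnertonDyer.Rank1Residual.F1Sign2
  Summit.BirchSwinnertonDyer.Rank1Residual.Supersingular
  Summit.BirchSwinnertonDyer.Rank1Residual.Supersingular.BlindLever
  Summit.BirchSwinnertonDyer.BirchSwinnertonDyer.Theorems
  Summit.BirchSwinnertonDyer.BirchSwinnertonDyer.Theorems.Rank1ResidualX1Defs
  Summit.BirchSwinnertonDyer.BirchSwinnertonDyer.Theorems.AlignedTransportAtTwoSeed
  Summit.BirchSwinnertonDyer.BirchSwinnertonDyer.Theorems.AlignedTransportAtTwoSeedLambdaCell
  Summit.BirchSwinnertonDyer.BirchSwinnertonDyer.Theorems.AlignedTransportAtTwoTwistSaturation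
  Summit.BirchSwinnertonDyer.BirchSwinnertonDyer.Theorems.AlignedTransportAtTwoLayerValueDoublyDark
  Summit.BirchSwinnertonDyer.BirchSwinnertonDyer.Theorems.TwoAdicEulerCharKernel

variable (κ : ZpExtension ℚ 2) (hκ : κ.IsCyclotomic) {γ : Field.absoluteGaloisGroup ℚ} (hγ : κ.IsTopGenerator γ)
  (hγ' : IsCyclotomicVariable 2 γ) (W : WeierstrassCurve ℚ) [W.IsElliptic] [W.IsGloballyMinimal]

include hκ hγ hγ' in
/-- ★★★ **THE CENSUS LAW «`λ_an ≥ 4` ON DOUBLY-DARK SEEDS» FROM GREENBERG'S CONJECTURE.** `W/ℚ` globally minimal, good ordinary at `2`, no rational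
point of order `2`, `r_an(W) = 0`; `f` a newform of `W` with an integral lift `G` of `L₂(f, α)` (`ι(G) = L₂`); PRINT `h17` (Kato for `f`), `hper`,
`hGZK`, `h114`. At a normalised cyclotomic dual datum `D` with generator `f_X`, `f_X(−2) ≠ 0`: if the Euler weight is `2`, the twin value
`ord₂ f_X(−2) = 2` («doubly dark») and `μ(X) = 0`, then **`4 ≤ λ(G)`** (`λ(X) ≥ 4` by `…LayerValueDoublyDark`, `λ(X) ≤ λ(G)` by Kato).
[cite: Kato2004Asterisque, Thm. 17.4 (1)(2) (p. 273)] [cite: GreenbergLNM1716, Thm. 1.14 (p. 68), Thm. 4.1 (p. 102)] -/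
theorem four_le_lam_lift_of_doublyDark_of_mu_eq_zero {N : ℕ} [NeZero N] {f : CuspForm (Gamma0 N) 2}
    (h17 : kato_divisibility_allPrimes W 2 (f := f)) (hper : realPeriodRat_eq_unit_mul_plusPeriod_two)
    (hGZK : rank_eq_analyticRank_of_analyticRank_le_one) (h114 : Greenberg1999_thm114_charIdeal_iota_invariant)
    (hord : IsOrdinaryAt W 2) (ht2 : ∀ x : ℚ, ¬ HasRationalTwoTorsionX W x) (hr : W.analyticRank = 0) (hf : IsNewformOf W f)
    (G : IwasawaAlgebra 2) (hG : iwasawaToPowerSeries 2 G = padicLFunction f (unitRoot W 2 : ℚ_[2]))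
    (D : W.SelmerDualData κ γ) {t e s : ℕ} (ht : Nat.card (AddCommGroup.primaryComponent W.toAffine.Point 2) = 2 ^ t)
    (he : Nat.card (AddCommGroup.primaryComponent ((integralModelInt W).map (Int.castRingHom (ZMod 2))).toAffine.Point 2) = 2 ^ e)
    (hs : Nat.card (W.selmerGroupPInfty 2) = 2 ^ s) (hw : padicValNat 2 W.tamagawaProduct + 2 * e + s - 2 * t = 2)
    {fX : IwasawaAlgebra 2} (hchar : D.charIdeal = Ideal.span {fX}) (h2 : evalAt (-2 : ℤ_[2]) fX ≠ 0)
    (htwin : (evalAt (-2 : ℤ_[2]) fX).valuation = 2) (hμ : D.mu = 0) : 4 ≤ lam G := by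
  have hfin : Finite (W.selmerGroupPInfty 2) := finite_selmerGroupPInfty_two_of_analyticRank_eq_zero W hGZK hr
  have h4 := Summit.BirchSwinnertonDyer.BirchSwinnertonDyer.Theorems.AlignedTransportAtTwoLayerValueDoublyDark.four_le_lambda_of_doublyDark_of_mu_eq_zero
    κ hκ hγ hγ' W h114 hord D hfin ht he hs hw hchar h2 htwin hμ
  have hk := lambda_le_lam_of_kato W h17 thm41_charValue_rankZero_anyPrime_holds hper hGZK hord ht2 hr hf G hG hκ hγ hγ' D
  omega

include hκ hγ hγ' in
/-- ★★★ **THE CHEAP FALSIFIER: a doubly-dark seed with `λ_an ≤ 3` refutes `μ = 0`.** Same setting; if some integral lift `G` of `L₂(f, α)` has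
`λ(G) ≤ 3` (e.g. `λ_an = 2`), then **`μ(X(W/ℚ_∞)) ≥ 1`** at the datum — Greenberg's `μ`-conjecture would FAIL for `W`. Census (bsd-2adic
S2TOWER ∩ g49's doubly-dark seeds): `λ_an ∈ {4, 6, 8, 10}` on 14/14, no violation. [cite: Kato2004Asterisque, Thm. 17.4 (1)(2) (p. 273)]
[cite: GreenbergLNM1716, Thm. 1.14 (p. 68), Thm. 4.1 (p. 102), Conj. 1.11] -/
theorem one_le_mu_of_doublyDark_of_lam_lift_le_three {N : ℕ} [NeZero N] {f : CuspForm (Gamma0 N) 2}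
    (h17 : kato_divisibility_allPrimes W 2 (f := f)) (hper : realPeriodRat_eq_unit_mul_plusPeriod_two)
    (hGZK : rank_eq_analyticRank_of_analyticRank_le_one) (h114 : Greenberg1999_thm114_charIdeal_iota_invariant)
    (hord : IsOrdinaryAt W 2) (ht2 : ∀ x : ℚ, ¬ HasRationalTwoTorsionX W x) (hr : W.analyticRank = 0) (hf : IsNewformOf W f)
    (G : IwasawaAlgebra 2) (hG : iwasawaToPowerSeries 2 G = padicLFunction f (unitRoot W 2 : ℚ_[2])) (hlamG : lam G ≤ 3)
    (D : W.SelmerDualData κ γ) {t e s : ℕ} (ht : Nat.card (AddCommGroup.primaryComponent W.toAffine.Point 2) = 2 ^ t)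
    (he : Nat.card (AddCommGroup.primaryComponent ((integralModelInt W).map (Int.castRingHom (ZMod 2))).toAffine.Point 2) = 2 ^ e)
    (hs : Nat.card (W.selmerGroupPInfty 2) = 2 ^ s) (hw : padicValNat 2 W.tamagawaProduct + 2 * e + s - 2 * t = 2)
    {fX : IwasawaAlgebra 2} (hchar : D.charIdeal = Ideal.span {fX}) (h2 : evalAt (-2 : ℤ_[2]) fX ≠ 0)
    (htwin : (evalAt (-2 : ℤ_[2]) fX).valuation = 2) : 1 ≤ D.mu := by
  by_contra hμ
  have hμ0 : D.mu = 0 := by omega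
  have := four_le_lam_lift_of_doublyDark_of_mu_eq_zero κ hκ hγ hγ' W h17 hper hGZK h114 hord ht2 hr hf G hG D ht he hs hw hchar h2 htwin hμ0
  omega

end Summit.BirchSwinnertonDyer.BirchSwinnertonDyer.Theorems.AlignedTransportAtTwoLayerValueDoublyDarkKato

end
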